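import Summits.QuantumFields.YangMills.Theorems.ColdStartUniversalityShenZhuZhuLimitVarianceSUN
import Summits.Ventures.YMGap.RobustBall.LoopActivity
import HarnessLib

/-!
# The IMAGINARY part of the Wilson loop variable `W_ℓ = Tr(Q_{e₁}⋯Q_{e_n})` for `SU(N)`, every `N`, every `d`: a smooth `mult_ℓ(e)/√N`-Lipschitz
# cylinder; `Var(Im W_ℓ/N) ≤ Σ_e mult_ℓ(e)²/(N K)` under every infinite-volume limit point and on every torus; Shen–Zhu–Zhu's loop-variance SHAPE
# `SZZLoopVarianceBound (fundamentalRep (Fin N)) d (Nβ) C` for EVERY `N` (`C ≥ 8/K`, `K = N/2 − 4dN|β|`)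

Seat `ym-line-csu-p1` (g39), route `ColdStartUniversality` of `Summits/QuantumFields/YangMills`, helper file G25 (strong coupling;
`--supports stmt-QuantumFields-24809`).  g38's G5 represented `Re W_ℓ/N` as a smooth link-Lipschitz cylinder (`exists_smooth_linkLipschitz_wilsonLoopObs`);
for `N ≥ 3` the trace of an `SU(N)` holonomy is complex and Shen–Zhu–Zhu's (1.12) bounds `Var(Re W_ℓ/N) + Var(Im W_ℓ/N)`.  Here the imaginary part gets
the same treatment (`|Im tr X| ≤ √N‖X‖_F`, the venture's one-link telescoping `suFrobDist_walkHolonomy_le_dartMult`), and G24's Poincaré inequality for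
limit points gives the loop-variance shape for every `N`:

* §1 `abs_im_trace_sub_le_suFrobDist`, `abs_imTrace_walkHolonomy_sub_le` (`|Im tr hol_U − Im tr hol_V|/N ≤ mult(e)/√N · ‖U_e − V_e‖_F` off one link),
  ★ `exists_smooth_linkLipschitz_wilsonLoopIm`.
* §2 ★★ `szz_wilsonLoopIm_variance_limit_sun` — `Var_μ(Im W_ℓ/N) ≤ Σ_e mult_ℓ(e)²/(N K)` for every infinite-volume limit point, every `N`, `d`.
* §3 ★★★ `szzLoopVarianceBound_sun` — `SZZLoopVarianceBound (fundamentalRep (Fin N)) d (Nβ) C` for EVERY `N ≥ 1`, `d`, `|β| < 1/(8d)` and every `C ≥ 8/K`: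
  `Var(Re W_ℓ/N) + Var(Im W_ℓ/N) ≤ 2n²/(N K) ≤ (8/K)·n(n−3)/N` for loops (`n ≥ 4`).  SZZ print `4/K_S` (their sharper gradient count); the factor is
  irrelevant for the large-`N` limit (G26).

THEOREMS ONLY, no definition, no sorry.  HONEST FRAMING: STRONG coupling, lattice; constant `8/K` instead of the printed `4/K_S`; nothing at weak coupling /
in the continuum, nothing `K`-uniform along the route's scaling (`UniformColdStartMixing`, 24809, ASIDE, not restated); no crux, rung or summit statement
is proved; the Yang–Mills mass gap is NOT proved.

References: H. Shen, R. Zhu, X. Zhu, CMP 400 (2023) 805–851 = arXiv:2204.12737, Cor. 1.5 (1.12), §4.2 [ShenZhuZhu2022].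
-/

set_option autoImplicit false

noncomputable section

namespace Summit.QuantumFields.YangMills.Theorems.ColdStartUniversality

open MeasureTheory ProbabilityTheory Finset Filter Set Function
open scoped BigOperators NNReal ENNReal Topology Matrix Matrix.Norms.Frobenius ContDiff
open SimpleGraph
open Literature.Probability.LatticeModels (zdGraph)
open Literature.MathematicalPhysics.QuantumFieldTheory
open Literature.MathematicalPhysics.QuantumLattice (fundamentalRep continuous_fundamentalRep fundamentalRep_apply torusEdge torusLift LGConfig
  infiniteVolumeLimitPoints normalisedCharacter wilsonLoopObs walkHolonomy dartHolonomy dartStep)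
open Literature.MathematicalPhysics.QuantumFieldTheory.SUNBakryEmery (SUN)
open Summit.Ventures.YMGap.RobustBall (dartMult suFrobDist_walkHolonomy_le_dartMult)

variable {d N : ℕ}

/-! ## §1. `Im W_ℓ/N` is a smooth `mult_ℓ(e)/√N`-Lipschitz cylinder -/

/-- `|Im tr a − Im tr b| ≤ √N ‖a − b‖_F` on `SU(N)` (`Im tr X = Re tr((−i)X)` and Cauchy–Schwarz). [folklore] -/
theorem abs_im_trace_sub_le_suFrobDist (a b : SUN N) :
    |(a : Matrix (Fin N) (Fin N) ℂ).trace.im - (b : Matrix (Fin N) (Fin N) ℂ).trace.im| ≤ Real.sqrt N * suFrobDist a b := by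
  have h := abs_re_trace_mul_le ((-Complex.I) • (1 : Matrix (Fin N) (Fin N) ℂ))
    ((a : Matrix (Fin N) (Fin N) ℂ) - (b : Matrix (Fin N) (Fin N) ℂ))
  rw [Matrix.smul_mul, Matrix.one_mul, Matrix.trace_smul, smul_eq_mul, frobNorm_smul, norm_neg, Complex.norm_I, one_mul,
    OneLinkLaplace.frobNorm_one] at h
  have hre : ((-Complex.I) * ((a : Matrix (Fin N) (Fin N) ℂ) - (b : Matrix (Fin N) (Fin N) ℂ)).trace).re =
      (a : Matrix (Fin N) (Fin N) ℂ).trace.im - (b : Matrix (Fin N) (Fin N) ℂ).trace.im := by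
    rw [Matrix.trace_sub, Complex.mul_re]
    simp
  rw [hre] at h
  exact h

/-- **One-link telescoping for `Im tr hol`**: if `U`, `V` agree off the link `y`, then
`|Im tr hol_U/N − Im tr hol_V/N| ≤ mult(y)/√N · ‖U_y − V_y‖_F`. [folklore] -/
theorem abs_imTrace_walkHolonomy_sub_le {x : Literature.Probability.LatticeModels.Site d} (w : (zdGraph d).Walk x x)
    {y : Literature.MathematicalPhysics.QuantumLattice.ZdEdge d} {U V : LGConfig d (SUN N)} (h : ∀ z, z ≠ y → U z = V z) :
    |((walkHolonomy U w : SUN N) : Matrix (Fin N) (Fin N) ℂ).trace.im / N - ((walkHolonomy V w : SUN N) : Matrix (Fin N) (Fin N) ℂ).trace.im / N| ≤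
      dartMult w y / Real.sqrt N * suFrobDist (U y) (V y) := by
  -- adapted from the venture's `abs_fundChar_walkHolonomy_sub_le` (RobustBall/LoopObservable.lean)
  rcases Nat.eq_zero_or_pos N with hN | hN
  · subst hN
    simp
  have hN0 : (0 : ℝ) < N := by exact_mod_cast hN
  have hs : 0 < Real.sqrt N := Real.sqrt_pos.2 hN0
  rw [← sub_div, abs_div, Nat.abs_cast]
  have key := (abs_im_trace_sub_le_suFrobDist (walkHolonomy U w) (walkHolonomy V w)).trans
    (mul_le_mul_of_nonneg_left (suFrobDist_walkHolonomy_le_dartMult w h) (Real.sqrt_nonneg _))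
  rw [div_le_iff₀ hN0]
  calc |((walkHolonomy U w : SUN N) : Matrix (Fin N) (Fin N) ℂ).trace.im - ((walkHolonomy V w : SUN N) : Matrix (Fin N) (Fin N) ℂ).trace.im|
      ≤ Real.sqrt N * (dartMult w y * suFrobDist (U y) (V y)) := key
    _ = dartMult w y / Real.sqrt N * suFrobDist (U y) (V y) * N := by
        rw [div_mul_eq_mul_div, div_mul_eq_mul_div, eq_div_iff hs.ne']
        calc Real.sqrt N * (dartMult w y * suFrobDist (U y) (V y)) * Real.sqrt N
            = (Real.sqrt N * Real.sqrt N) * (dartMult w y * suFrobDist (U y) (V y)) := by ring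
          _ = dartMult w y * suFrobDist (U y) (V y) * N := by rw [Real.mul_self_sqrt hN0.le]; ring

/-- ★ **`Im W_ℓ/N` as a smooth link-Lipschitz cylinder** (every `d`, `N`): there is a smooth `f` over `links(ℓ)` with
`matrixCylinder links(ℓ) f U = Im tr hol_ℓ(U)/N` and `|f(M) − f(M')| ≤ mult_ℓ(e)/√N · ‖M_e − M'_e‖_F` off one link. [cite: ShenZhuZhu2022, §4.2] -/
theorem exists_smooth_linkLipschitz_wilsonLoopIm {x : Literature.Probability.LatticeModels.Site d} (w : (zdGraph d).Walk x x) :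
    ∃ f : (↥(walkEdges w) → Matrix (Fin N) (Fin N) ℂ) → ℝ,
      ContDiff ℝ ∞ f ∧
      (∀ U : LGConfig d (SUN N), matrixCylinder (walkEdges w) f U = (wilsonLoopTrace (fundamentalRep (Fin N)) w U).im / N) ∧
      (∀ (e : ↥(walkEdges w)) (M M' : ↥(walkEdges w) → SUN N), (∀ e', e' ≠ e → M e' = M' e') →
        |f (fun e' => (M e' : Matrix (Fin N) (Fin N) ℂ)) - f (fun e' => (M' e' : Matrix (Fin N) (Fin N) ℂ))| ≤
          (dartMult w (e : Literature.MathematicalPhysics.QuantumLattice.ZdEdge d) : ℝ) / Real.sqrt (N : ℝ) * suFrobDist (M e) (M' e)) := by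
  -- adapted from g38's `exists_smooth_linkLipschitz_wilsonLoopObs` (…ShenZhuZhuWilsonLoopConcentrationSU2)
  classical
  set Λ : Finset (Literature.MathematicalPhysics.QuantumLattice.ZdEdge d) := walkEdges w with hΛ
  set ext : (↥Λ → Matrix (Fin N) (Fin N) ℂ) → Literature.MathematicalPhysics.QuantumLattice.ZdEdge d →
      Matrix (Fin N) (Fin N) ℂ := fun m z => if h : z ∈ Λ then m ⟨z, h⟩ else 1 with hext
  set step : (↥Λ → Matrix (Fin N) (Fin N) ℂ) → (zdGraph d).Dart → Matrix (Fin N) (Fin N) ℂ :=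
    fun m a => if (dartStep a).2 then ext m (dartStep a).1 else (ext m (dartStep a).1)ᴴ with hstep
  set fW : (↥Λ → Matrix (Fin N) (Fin N) ℂ) → ℝ := fun m => ((w.darts.map (step m)).prod).trace.im / N with hfW
  -- (1) the word of step matrices is the holonomy
  have hprod : ∀ U : LGConfig d (SUN N),
      (w.darts.map (step fun e : ↥Λ => ((U e : SUN N) : Matrix (Fin N) (Fin N) ℂ))).prod =
        ((walkHolonomy U w : SUN N) : Matrix (Fin N) (Fin N) ℂ) := by
    intro U
    unfold walkHolonomy
    rw [Submonoid.coe_list_prod, List.map_map]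
    refine congrArg List.prod (List.map_congr_left fun a ha => ?_)
    have hmem : (dartStep a).1 ∈ Λ := by
      rw [hΛ]; unfold walkEdges
      exact List.mem_toFinset.2 (List.mem_map.2 ⟨a, ha, rfl⟩)
    simp only [hstep, hext, dif_pos hmem, Function.comp_apply, dartHolonomy]
    split_ifs
    · rfl
    · exact (su_coe_inv _).symm
  have hrep : ∀ U : LGConfig d (SUN N), matrixCylinder Λ fW U = (wilsonLoopTrace (fundamentalRep (Fin N)) w U).im / N := by
    intro U
    unfold matrixCylinder
    simp only [hfW, wilsonLoopTrace_apply, fundamentalRep_apply]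
    rw [hprod U]
  -- (2) smoothness
  have hext_cd : ∀ z, ContDiff ℝ ∞ (fun m : ↥Λ → Matrix (Fin N) (Fin N) ℂ => ext m z) := by
    intro z
    by_cases hz : z ∈ Λ
    · have h1 : (fun m : ↥Λ → Matrix (Fin N) (Fin N) ℂ => ext m z) = fun m => m ⟨z, hz⟩ := by
        funext m; simp only [hext, dif_pos hz]
      rw [h1]; exact contDiff_apply ℝ (Matrix (Fin N) (Fin N) ℂ) (⟨z, hz⟩ : ↥Λ)
    · have h1 : (fun m : ↥Λ → Matrix (Fin N) (Fin N) ℂ => ext m z) = fun _ => 1 := by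
        funext m; simp only [hext, dif_neg hz]
      rw [h1]; exact contDiff_const
  have hct : ContDiff ℝ ∞ (fun M : Matrix (Fin N) (Fin N) ℂ => Mᴴ) := by
    let T : Matrix (Fin N) (Fin N) ℂ →L[ℝ] Matrix (Fin N) (Fin N) ℂ :=
      LinearMap.toContinuousLinearMap
        { toFun := fun M => Mᴴ
          map_add' := fun A B => Matrix.conjTranspose_add A B
          map_smul' := fun c A => by rw [Matrix.conjTranspose_smul, star_trivial, RingHom.id_apply] }
    exact T.contDiff
  have hstep_cd : ∀ a, ContDiff ℝ ∞ (fun m : ↥Λ → Matrix (Fin N) (Fin N) ℂ => step m a) := by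
    intro a
    cases hb : (dartStep a).2
    · have h1 : (fun m : ↥Λ → Matrix (Fin N) (Fin N) ℂ => step m a) = fun m => (ext m (dartStep a).1)ᴴ := by
        funext m; simp only [hstep, hb, Bool.false_eq_true, if_false]
      rw [h1]; exact hct.comp (hext_cd _)
    · have h1 : (fun m : ↥Λ → Matrix (Fin N) (Fin N) ℂ => step m a) = fun m => ext m (dartStep a).1 := by
        funext m; simp only [hstep, hb, if_true]
      rw [h1]; exact hext_cd _
  have hword : ∀ l : List ((zdGraph d).Dart),
      ContDiff ℝ ∞ (fun m : ↥Λ → Matrix (Fin N) (Fin N) ℂ => (l.map (step m)).prod) := by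
    intro l
    induction l with
    | nil =>
      simp only [List.map_nil, List.prod_nil]
      exact contDiff_const
    | cons a l ih =>
      simp only [List.map_cons, List.prod_cons]
      exact (hstep_cd a).mul ih
  have hit : ContDiff ℝ ∞ (fun M : Matrix (Fin N) (Fin N) ℂ => M.trace.im) := by
    let T : Matrix (Fin N) (Fin N) ℂ →L[ℝ] ℝ :=
      LinearMap.toContinuousLinearMap
        { toFun := fun M => M.trace.im
          map_add' := fun A B => by simp [Matrix.trace_add]
          map_smul' := fun r A => by simp [Matrix.trace_smul] }
    exact T.contDiff
  have hcd : ContDiff ℝ ∞ fW := by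
    rw [hfW]
    exact (hit.comp (hword w.darts)).div_const _
  -- (3) the Lipschitz bound
  refine ⟨fW, hcd, hrep, fun e M M' hMM' => ?_⟩
  set U : LGConfig d (SUN N) := fun z => if h : z ∈ Λ then M ⟨z, h⟩ else 1 with hU
  set V : LGConfig d (SUN N) := fun z => if h : z ∈ Λ then M' ⟨z, h⟩ else 1 with hV
  have hUM : (fun e' : ↥Λ => ((U e' : SUN N) : Matrix (Fin N) (Fin N) ℂ)) = fun e' => (M e' : Matrix (Fin N) (Fin N) ℂ) := by
    funext e'; simp only [hU, dif_pos e'.2, Subtype.coe_eta]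
  have hVM : (fun e' : ↥Λ => ((V e' : SUN N) : Matrix (Fin N) (Fin N) ℂ)) = fun e' => (M' e' : Matrix (Fin N) (Fin N) ℂ) := by
    funext e'; simp only [hV, dif_pos e'.2, Subtype.coe_eta]
  have hUV : ∀ z, z ≠ (e : Literature.MathematicalPhysics.QuantumLattice.ZdEdge d) → U z = V z := by
    intro z hz
    by_cases h : z ∈ Λ
    · have hne : (⟨z, h⟩ : ↥Λ) ≠ e := fun h' => hz (congrArg Subtype.val h')
      simp only [hU, hV, dif_pos h, hMM' _ hne]
    · simp only [hU, hV, dif_neg h]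
  have hM1 : fW (fun e' => (M e' : Matrix (Fin N) (Fin N) ℂ)) = ((walkHolonomy U w : SUN N) : Matrix (Fin N) (Fin N) ℂ).trace.im / N := by
    rw [← hUM]; simp only [hfW]; rw [hprod U]
  have hM2 : fW (fun e' => (M' e' : Matrix (Fin N) (Fin N) ℂ)) = ((walkHolonomy V w : SUN N) : Matrix (Fin N) (Fin N) ℂ).trace.im / N := by
    rw [← hVM]; simp only [hfW]; rw [hprod V]
  have hUe : U e = M e := by simp only [hU, dif_pos e.2, Subtype.coe_eta]
  have hVe : V e = M' e := by simp only [hV, dif_pos e.2, Subtype.coe_eta]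
  have key := abs_imTrace_walkHolonomy_sub_le w (U := U) (V := V) hUV
  rw [hUe, hVe] at key
  rw [hM1, hM2]
  exact key

/-! ## §2. Variance of `Im W_ℓ/N` under every infinite-volume limit point -/

/-- ★★ **Variance of the imaginary part of the Wilson loop variable, every `SU(N)`, every `d`**: for `K = N/2 − 4dN|β| > 0`, every infinite-volume
limit point `μ` and every closed lattice walk `ℓ`, `Var_μ(Im W_ℓ/N) ≤ Σ_{e∈links(ℓ)} mult_ℓ(e)²/(N K)`.  The Yang–Mills mass gap is NOT proved.
[cite: ShenZhuZhu2022, Corollary 1.5 (1.12)] -/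
theorem szz_wilsonLoopIm_variance_limit_sun (hN : N ≠ 0) {β : ℝ} (hK : 0 < (N : ℝ) / 2 - N * |β| * (4 * d))
    {μ : Measure (LGConfig d (SUN N))} (hμ : μ ∈ infiniteVolumeLimitPoints (d := d) (fundamentalRep (Fin N)) ((N : ℝ) * β))
    {x : Literature.Probability.LatticeModels.Site d} (w : (zdGraph d).Walk x x) :
    Var[fun U : LGConfig d (SUN N) => (wilsonLoopTrace (fundamentalRep (Fin N)) w U).im / N; μ] ≤
      (∑ e ∈ walkEdges w, (dartMult w e : ℝ) ^ 2) / (N * ((N : ℝ) / 2 - N * |β| * (4 * d))) := by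
  classical
  obtain ⟨f, hf, hrep, hLip⟩ := exists_smooth_linkLipschitz_wilsonLoopIm (N := N) w
  set ℓ : ↥(walkEdges w) → ℝ := fun e =>
    (dartMult w (e : Literature.MathematicalPhysics.QuantumLattice.ZdEdge d) : ℝ) / Real.sqrt (N : ℝ) with hℓdef
  have hℓ : ∀ e, 0 ≤ ℓ e := fun e => div_nonneg (Nat.cast_nonneg _) (Real.sqrt_nonneg _)
  have hsum : ∑ e, ℓ e ^ 2 = (∑ e ∈ walkEdges w, (dartMult w e : ℝ) ^ 2) / N := by
    have h2 : Real.sqrt (N : ℝ) ^ 2 = N := Real.sq_sqrt (Nat.cast_nonneg _)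
    simp only [hℓdef, div_pow, h2]
    rw [← Finset.sum_div, Finset.sum_coe_sort (walkEdges w) (fun e => (dartMult w e : ℝ) ^ 2)]
  have h := szz_cylinder_variance_limit_sun hN hK hμ (walkEdges w) f hf ℓ hℓ hLip
  have hF : matrixCylinder (walkEdges w) f = fun U : LGConfig d (SUN N) => (wilsonLoopTrace (fundamentalRep (Fin N)) w U).im / N :=
    funext hrep
  rw [hF, hsum, div_div] at h
  exact h

/-! ## §3. Shen–Zhu–Zhu's loop-variance shape for every `SU(N)` -/

/-- ★★★ **Shen–Zhu–Zhu's loop-variance shape `SZZLoopVarianceBound (fundamentalRep (Fin N)) d (Nβ) C` for EVERY `N ≥ 1`, every `d`, `|β| < 1/(8d)`,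
every `C ≥ 8/K`** (`K = N/2 − 4dN|β|`): under every infinite-volume limit point, for every loop `ℓ` (non-backtracking, `n ≥ 4` edges),
`Var(Re W_ℓ/N) + Var(Im W_ℓ/N) ≤ 2·Σ_e mult² /(N K) ≤ 2n²/(N K) ≤ C·n(n−3)/N`.  SZZ print `C = 4/K_S`.  The Yang–Mills mass gap is NOT proved.
[cite: ShenZhuZhu2022, Corollary 1.5 (1.12)] -/
theorem szzLoopVarianceBound_sun (hN : N ≠ 0) {β : ℝ} (hK : 0 < (N : ℝ) / 2 - N * |β| * (4 * d)) {C : ℝ}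
    (hC : 8 / ((N : ℝ) / 2 - N * |β| * (4 * d)) ≤ C) :
    SZZLoopVarianceBound (fundamentalRep (Fin N)) d ((N : ℝ) * β) C := by
  intro μ hμ x w hw
  set K : ℝ := (N : ℝ) / 2 - N * |β| * (4 * d) with hKdef
  have hNpos : (0 : ℝ) < N := by exact_mod_cast Nat.pos_of_ne_zero hN
  have h4 : (4 : ℝ) ≤ w.length := by exact_mod_cast four_le_length_of_isNonBacktrackingLoop hw
  have hre : (fun U : LGConfig d (SUN N) => (wilsonLoopTrace (fundamentalRep (Fin N)) w U).re / (N : ℝ)) =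
      wilsonLoopObs (fun g : SUN N => normalisedCharacter N (fundamentalRep (Fin N) g)) w := by
    funext U
    unfold wilsonLoopObs normalisedCharacter wilsonLoopTrace
    rw [div_eq_inv_mul]
  rw [hre]
  have hVr := szz_wilsonLoop_variance_limit_sun hN hK hμ w
  have hVi := szz_wilsonLoopIm_variance_limit_sun hN hK hμ w
  have hS := sum_dartMult_sq_le_length_sq w
  have hnn : 0 ≤ (w.length : ℝ) * ((w.length : ℝ) - 3) := by nlinarith
  have hNK : 0 < (N : ℝ) * K := mul_pos hNpos hK
  calc Var[wilsonLoopObs (fun g : SUN N => normalisedCharacter N (fundamentalRep (Fin N) g)) w; μ] +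
        Var[fun U : LGConfig d (SUN N) => (wilsonLoopTrace (fundamentalRep (Fin N)) w U).im / (N : ℝ); μ]
      ≤ (∑ e ∈ walkEdges w, (dartMult w e : ℝ) ^ 2) / (N * K) + (∑ e ∈ walkEdges w, (dartMult w e : ℝ) ^ 2) / (N * K) := add_le_add hVr hVi
    _ ≤ (w.length : ℝ) ^ 2 / (N * K) + (w.length : ℝ) ^ 2 / (N * K) :=
        add_le_add (div_le_div_of_nonneg_right hS hNK.le) (div_le_div_of_nonneg_right hS hNK.le)
    _ ≤ 8 / K * ((w.length : ℝ) * ((w.length : ℝ) - 3) / (N : ℝ)) := by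
        rw [← two_mul, ← mul_div_assoc, div_le_iff₀ hNK]
        have e : 8 / K * ((w.length : ℝ) * ((w.length : ℝ) - 3) / (N : ℝ)) * (N * K) = 8 * ((w.length : ℝ) * ((w.length : ℝ) - 3)) := by
          field_simp
        rw [e]
        nlinarith
    _ ≤ C * ((w.length : ℝ) * ((w.length : ℝ) - 3) / (N : ℝ)) := mul_le_mul_of_nonneg_right hC (div_nonneg hnn hNpos.le)

end Summit.QuantumFields.YangMills.Theorems.ColdStartUniversality

end
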